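import Mathlib
import HarnessLib
import Summits.ResolutionOfSingularities.ResolutionOfSingularities.Theorems.WildQuotientsWildQuotientResolutionThirdConeChartCube

/-!
# Theorem T3, tools: the `ZMod 3` weight split into weight-`1` and weight-`2` counts
(crux stmt-ResolutionOfSingularities-15640, line `Sketch`; chain w45c next rung R-T, «conjecture T3»,
res-L1-w45c-plan-1 GO 2026-08-27T10:03:49Z; vocabulary `ThirdCone.*` (p522660); [OURS · L1 W4.5c] —
NOT a statement of any manuscript. Prover res-L1-w45c-stub-2.)

* `ThirdCone.eq_zero_or_one_or_two` — trichotomy in `ZMod 3`;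
* `ThirdCone.weight_eq_chi` — `weight w e = #{weight-1 exponents} + 2·#{weight-2 exponents}` (with
  multiplicity), the bookkeeping of the mixed chart `D₊(x_ix_z t)` (`…ThirdConeChartMixed`).
-/

-- single-problem summit: the doubled namespace component `ResolutionOfSingularities` is forced
set_option linter.dupNamespace false

noncomputable section

open MvPolynomial

namespace Summit.ResolutionOfSingularities.ResolutionOfSingularities.Theorems.WildQuotientResolution.ThirdCone

variable (n : ℕ) (w : Fin n → ZMod 3)

/-! ## Small tools -/

/-- Every element of `ZMod 3` is `0`, `1` or `2`. [folklore] -/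
theorem eq_zero_or_one_or_two : ∀ b : ZMod 3, b = 0 ∨ b = 1 ∨ b = 2 := by decide

/-- The weight as `#(weight-1 exponents) + 2 · #(weight-2 exponents)`. [folklore] -/
theorem weight_eq_chi (e : Fin n →₀ ℕ) :
    Finsupp.weight w e =
      (((∑ s, e s * (if w s = 1 then 1 else 0)) : ℕ) : ZMod 3) +
        2 * (((∑ s, e s * (if w s = 2 then 1 else 0)) : ℕ) : ZMod 3) := by
  classical
  rw [weight_eq_sum, Nat.cast_sum, Nat.cast_sum, Finset.mul_sum, ← Finset.sum_add_distrib]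
  refine Finset.sum_congr rfl fun s _ => ?_
  have key : ∀ a : ZMod 3, a = ((if a = 1 then 1 else 0 : ℕ) : ZMod 3) +
      2 * ((if a = 2 then 1 else 0 : ℕ) : ZMod 3) := by decide
  rw [Nat.cast_mul, Nat.cast_mul]
  linear_combination (e s : ZMod 3) * key (w s)


end Summit.ResolutionOfSingularities.ResolutionOfSingularities.Theorems.WildQuotientResolution.ThirdCone

end
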